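import Summits.NavierStokesRegularity.FunctionalMining.NoGo.TopBotEigSplitShareWallLine
import Summits.NavierStokesRegularity.FunctionalMining.NoGo.TopBotEigSplitShareNecessity
import HarnessLib

/-!
# FunctionalMining — the PLANAR share ceiling `c_pl(q) = ((q − 1)/3)·2^{1 − q/2}` of the symmetrised
# top–bottom splitting, every real `q > 1`; below `q = 2` it is the binding ceiling (and, with the sequels, the window)

HONEST FRAMING. Search for candidate a priori estimates; no regularity claim. Nothing about Navier–Stokes is
proved or asserted in this file: a finite-dimensional statement about convex functions on flat `3 × 3` tensors,
proved with one-variable calculus (real powers). Cell `pub-nsfunc`, prove seat (gen 27), own kernel work on the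
door D-K6 (c) share window `{c | TopBotEigSplitting q c}` (K9 `NoGo/TopBotEigHeatCoerciveSplit`: a convex
`1`-Lipschitz `h ≥ 0` and `M ≥ 0` with `λ(A)^q + λ(−A)^q = M·h(A)^q + c‖A‖^q` on symmetric trace-free `A`).

THE MECHANISM. K14/K16 (`NoGo/TopBotEigSplitShareNecessity`, `NoGo/TopBotEigSplitShareWallLine`/`…Main`) test a
splitting along the diagonal line `A(u) = diag(u, 1 − 2u, u − 1)`, `u ∈ [1/3, 2/3]`, on which
`M·h(A(u))^q = N(u) := u^q + (1 − u)^q − c(6u² − 6u + 2)^{q/2}` (`lineN`), and read the loss of convexity of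
`N^{1/q}` at the axisymmetric WALLS `u = 1/3, 2/3`: this gives the ceiling `c ≤ c_axi(q)` for every real `q > 1`,
attained at `q = 2, 3, 4, 6, 8` (K20b, K21, K17, K22, K23). This file reads the same line at its PLANAR MIDPOINT
`u = 1/2` (`A(1/2) = diag(1/2, 0, −1/2)`: pure shear, middle eigenvalue `0`), where `N′(1/2) = 0` by the symmetry
`u ↦ 1 − u` and

  `N″(1/2) = 6q·2^{1 − q/2}·(c_pl(q) − c)`,   `c_pl(q) := ((q − 1)/3)·2^{1 − q/2}`   (`lineN2_half_eq_cPlanar`),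

so that `T(1/2) = q·N(1/2)·N″(1/2)` vanishes exactly at `c = c_pl(q)` (`lineT_half_cPlanar`) — the convexity
defect of `N^{1/q}` is TIGHT AT THE MIDPOINT at the planar share, as it is tight at the walls at the axisymmetric
share.

WHAT IS PROVED HERE [ours]:
* §P2 **`topBotEigSplitting_share_le_cPlanar (hq : 1 < q) : TopBotEigSplitting q c → c ≤ cPlanar q`** — every
  real `q > 1`. Proof WITHOUT differentiating `h`: with `g(u) = h(A(u))` (convex, `≥ 0`, `M·g^q = N` on
  `[1/3, 2/3]`), either `M = 0` and `N ≡ 0` there, or `M > 0` and `g = (N/M)^{1/q}` inherits the symmetry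
  `u ↦ 1 − u` of `N` on `[1/3, 2/3]`; a convex function symmetric about `1/2` is monotone on `[1/2, 2/3]`
  (`lineN_monotoneOn_of_splitting`), hence `N′ ≥ 0` on `(1/2, 2/3)` (`lineN1_nonneg_of_splitting`, Mathlib
  `MonotoneOn.derivWithin_nonneg`), hence `N″(1/2) ≥ 0` as the limit of the non-negative slopes of `N′` from
  `N′(1/2) = 0` (`lineN2_half_nonneg_of_splitting`, `hasDerivWithinAt_iff_tendsto_slope'`), i.e. `c ≤ c_pl(q)`.
  Corollaries `not_topBotEigSplitting_of_cPlanar_lt`, `share_le_cPlanar_of_convex_splitting` (obligation written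
  out), and by value `topBotEigSplitting_three_halves_share_lt : TopBotEigSplitting (3/2) c → c < 1/5`.
* §P1 the constant and the midpoint values: `cPlanar_two = 1/3` (`= c_axi(2)`: the two ceilings AGREE at `q = 2`),
  `cPlanar_four = 1/2` (`> 2/9 = c_axi(4)`), `cPlanar_three_halves = 2^{1/4}/6` (`< 1/5`, while
  `c_axi(3/2) ≈ 0.2542` by value — not proved here), `lineN1_half`, `lineN2_half(_eq)`, `lineT_half`,
  `lineT_half_cPlanar`, `lineT_half_neg`.
* §P3 for `1 < q ≤ 2`, AT `c = c_pl(q)`, the first two hypotheses of K19's one-dimensional criterion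
  (`NoGo/TopBotEigSplitWallOneDim.topBotEigSplitting_of_line`: (N⁺) ∧ (D) ∧ (W) ⟹ `TopBotEigSplitting q c`):
  **`lineN_cPlanar_pos`** ((N⁺): `0 < N` on `[1/3, 2/3]`) and **`lineD_cPlanar`**
  ((D): `c_pl(q)·(3u − 1)·(6u² − 6u + 2)^{q/2 − 1} ≤ u^{q − 1}` on `[1/3, 2/3]`), by elementary `rpow` monotonicity.

SEQUEL FILES (prove seat gen 27, same day). `TopBotEigSplitSharePlanarLine` proves the closed form
`T = q²[(q−1)(u(1−u))^{q−2} + 3c²s^{q−2} − 3c(2−q)(u^q + (1−u)^q)s^{q/2−2} − 2c(q−1)(u^{q−2} + (1−u)^{q−2})s^{q/2−1}]`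
(every real `q`, `c`) and (W) `0 ≤ lineT q (cPlanar q) u` on all of `(0, 1)` for `1 < q ≤ 7/4`;
`TopBotEigSplitSharePlanarSector` proves (W) on the sector `(1/3, 2/3)` for EVERY `1 < q ≤ 2` (one monotone function of
`x = 2s ∈ [1, 4/3]`); `TopBotEigSplitSharePlanarWindow` composes with K19 (`topBotEigSplitting_of_line`) and K20a
(downward closure): **`{c | TopBotEigSplitting q c} = Iic (cPlanar q)` for every real `1 < q ≤ 2`** — the share
window below (and at) `q = 2` in closed form, binding at the planar point; above `2` the binding ceiling is K16's
`c_axi(q)` (`c_pl(q) > c_axi(q)` there, e.g. `c_pl(4) = 1/2 > 2/9`).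

NOT CLAIMED. No sufficiency for any `q < 2`; nothing on `heatDissipation` / `TopBotEigHeatCoercivePos` (door (c)
below `2` has a positive share by K13, independently of the sharp value); no `𝒦₀` row, no count, no numerics of
record; no Navier–Stokes statement. Tree results used, by name: K9 `TopBotEigSplitting`; K14 `lineTens`,
`lineTens_symm/_trace/_affine`, `lam_lineTens`, `lam_neg_lineTens`, `norm_sq_lineTens`; K16 part 1 `lineNsq(_pos)`,
`lineN`, `lineN1`, `lineN2`, `lineT`, `hasDerivAt_lineN`, `hasDerivAt_lineN1`; Mathlib `MonotoneOn.derivWithin_nonneg`,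
`derivWithin_of_isOpen`, `hasDerivWithinAt_iff_tendsto_slope'`, `left_nhdsWithin_Ioo_neBot`, `ge_of_tendsto`,
`convexOn_rpow`, `Real.rpow_le_rpow_of_nonpos`, `Real.rpow_le_rpow_of_exponent_ge/_le`, `Real.pow_rpow_inv_natCast`.
[ours] = this programme's own elementary work. search for candidate a priori estimates; no regularity claim.
-/

open Set Filter Topology

noncomputable section

namespace Summit.NavierStokesRegularity.FunctionalMining

namespace TopEig

/-! ## P1. The planar share `c_pl(q) = ((q − 1)/3)·2^{1 − q/2}` and the midpoint values of the line functions -/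

/-- **The planar share** `c_pl(q) := ((q − 1)/3)·2^{1 − q/2}`: the share at which `N″(1/2) = 0`, i.e. at which
the second derivative of `N = λ^q + λ(−·)^q − c‖·‖^q` along the test line `A(u) = diag(u, 1 − 2u, u − 1)`
vanishes at the PLANAR midpoint `A(1/2) = diag(1/2, 0, −1/2)` (pure shear, middle eigenvalue `0`).
`c_pl(2) = 1/3 = c_axi(2)`, `c_pl(3/2) = 2^{1/4}/6 ≈ 0.198`, `c_pl(4) = 1/2`. [ours] -/
def cPlanar (q : ℝ) : ℝ := (q - 1) / 3 * 2 ^ (1 - q / 2)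

/-- `c_pl(q) > 0` for `q > 1`. [bookkeeping] -/
theorem cPlanar_pos {q : ℝ} (hq : 1 < q) : 0 < cPlanar q :=
  mul_pos (div_pos (by linarith) three_pos) (Real.rpow_pos_of_pos two_pos _)

/-- `c_pl(2) = 1/3` (`= c_axi(2)`, K16/K20b: the two ceilings agree at `q = 2`). [bookkeeping] -/
theorem cPlanar_two : cPlanar 2 = 1 / 3 := by
  rw [cPlanar, show (1 : ℝ) - 2 / 2 = 0 by norm_num, Real.rpow_zero]; norm_num

/-- `c_pl(4) = 1/2` (`> 2/9 = c_axi(4)`: above `q = 2` the planar ceiling is not the binding one). [bookkeeping] -/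
theorem cPlanar_four : cPlanar 4 = 1 / 2 := by
  rw [cPlanar, show (1 : ℝ) - 4 / 2 = -1 by norm_num, Real.rpow_neg_one]; norm_num

/-- `c_pl(3/2) = 2^{1/4}/6`. [bookkeeping] -/
theorem cPlanar_three_halves : cPlanar (3 / 2) = (2 : ℝ) ^ (1 / 4 : ℝ) / 6 := by
  rw [cPlanar, show (1 : ℝ) - 3 / 2 / 2 = 1 / 4 by norm_num]; ring

/-- `c_pl(3/2) < 1/5` (by value: `2^{1/4} < 6/5` since `2 < (6/5)⁴ = 1296/625`). [bookkeeping] -/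
theorem cPlanar_three_halves_lt : cPlanar (3 / 2) < 1 / 5 := by
  rw [cPlanar_three_halves]
  have h4 : (6 / 5 : ℝ) = ((6 / 5 : ℝ) ^ (4 : ℕ)) ^ ((4 : ℕ) : ℝ)⁻¹ :=
    (Real.pow_rpow_inv_natCast (by norm_num) four_ne_zero).symm
  have h : (2 : ℝ) ^ (1 / 4 : ℝ) < 6 / 5 := by
    rw [h4, show (1 / 4 : ℝ) = ((4 : ℕ) : ℝ)⁻¹ by norm_num]
    exact Real.rpow_lt_rpow (by norm_num) (by norm_num) (by norm_num)
  linarith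

/-- `‖A(1/2)‖² = 1/2`. [bookkeeping] -/
theorem lineNsq_half : lineNsq (1 / 2) = 1 / 2 := by norm_num [lineNsq]

/-- `N′(1/2) = 0`. [bookkeeping] -/
theorem lineN1_half (q c : ℝ) : lineN1 q c (1 / 2) = 0 := by
  simp only [lineN1]; norm_num

/-- `N″(1/2) = 2q(q − 1)(1/2)^{q−2} − 6qc(1/2)^{q/2−1}`. [bookkeeping] -/
theorem lineN2_half (q c : ℝ) :
    lineN2 q c (1 / 2) = 2 * q * (q - 1) * (1 / 2 : ℝ) ^ (q - 2) - 6 * q * c * (1 / 2 : ℝ) ^ (q / 2 - 1) := by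
  simp only [lineN2, lineNsq_half]; norm_num; ring

/-- `T(1/2) = q·N(1/2)·N″(1/2)` (since `N′(1/2) = 0`). [bookkeeping] -/
theorem lineT_half (q c : ℝ) : lineT q c (1 / 2) = q * lineN q c (1 / 2) * lineN2 q c (1 / 2) := by
  simp only [lineT, lineN1_half]; ring

/-- `(1/2)^{q/2 − 1} = 2^{1 − q/2}`. [bookkeeping] -/
theorem half_rpow_half_sub_one (q : ℝ) : (1 / 2 : ℝ) ^ (q / 2 - 1) = 2 ^ (1 - q / 2) := by
  rw [one_div, Real.inv_rpow (by norm_num : (0 : ℝ) ≤ 2), ← Real.rpow_neg (by norm_num : (0 : ℝ) ≤ 2)]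
  congr 1; ring

/-- `(1/2)^{q − 2} = ((1/2)^{q/2 − 1})²`. [bookkeeping] -/
theorem half_rpow_sub_two (q : ℝ) : (1 / 2 : ℝ) ^ (q - 2) = ((1 / 2 : ℝ) ^ (q / 2 - 1)) ^ 2 := by
  rw [← Real.rpow_mul_natCast (by norm_num : (0 : ℝ) ≤ 1 / 2)]; congr 1; push_cast; ring

/-- `N″(1/2) = 2q·2^{1−q/2}·((q − 1)·2^{1−q/2} − 3c)`: AFFINE DECREASING in the share, zero exactly at
`c = c_pl(q)`. [ours] -/
theorem lineN2_half_eq (q c : ℝ) :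
    lineN2 q c (1 / 2) = 2 * q * 2 ^ (1 - q / 2) * ((q - 1) * 2 ^ (1 - q / 2) - 3 * c) := by
  rw [lineN2_half, half_rpow_sub_two, half_rpow_half_sub_one]; ring

/-- `N″(1/2) = 6q·2^{1−q/2}·(c_pl(q) − c)`. [ours] -/
theorem lineN2_half_eq_cPlanar (q c : ℝ) :
    lineN2 q c (1 / 2) = 6 * q * 2 ^ (1 - q / 2) * (cPlanar q - c) := by
  rw [lineN2_half_eq, cPlanar]; ring

/-- **`T(1/2) = 0` at `c = c_pl(q)`, every real `q`**: at the planar share the convexity defect of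
`N^{1/q}` is TIGHT at the planar midpoint (compare K16 `lineT_two_thirds`: at `c = c_axi(q)` it is tight at the
axisymmetric walls). [ours] -/
theorem lineT_half_cPlanar (q : ℝ) : lineT q (cPlanar q) (1 / 2) = 0 := by
  rw [lineT_half, lineN2_half_eq_cPlanar, sub_self, mul_zero, mul_zero]

/-- `T(1/2) < 0` for `c_pl(q) < c` with `N(1/2) > 0`, `q > 0`. [ours] -/
theorem lineT_half_neg {q c : ℝ} (hq : 0 < q) (hc : cPlanar q < c) (hN : 0 < lineN q c (1 / 2)) :
    lineT q c (1 / 2) < 0 := by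
  rw [lineT_half, lineN2_half_eq_cPlanar]
  have h2 : 0 < (2 : ℝ) ^ (1 - q / 2) := Real.rpow_pos_of_pos two_pos _
  have hneg : 6 * q * 2 ^ (1 - q / 2) * (cPlanar q - c) < 0 :=
    mul_neg_of_pos_of_neg (by positivity) (by linarith)
  exact mul_neg_of_pos_of_neg (mul_pos hq hN) hneg

/-! ## P2. A convex splitting makes `N` monotone on `[1/2, 2/3]`; hence `N″(1/2) ≥ 0`, i.e. `c ≤ c_pl(q)` -/

/-- **From a splitting, `N` is monotone on `[1/2, 2/3]`.** With `g(u) := h(A(u))` (convex, `≥ 0`,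
`M·g^q = N` on `[1/3, 2/3]`): if `M = 0` then `N ≡ 0` there; if `M > 0` then `g = (N/M)^{1/q}` inherits the
symmetry `u ↦ 1 − u` of `N` on `[1/3, 2/3]`, and a convex function symmetric about `1/2` is monotone on
`[1/2, 2/3]` (write `x ∈ [1/2, y]` as a convex combination of `1 − y` and `y`). No derivative of `h` is used.
[ours] -/
theorem lineN_monotoneOn_of_splitting {q c : ℝ} (hq : 1 < q) (hs : TopBotEigSplitting q c) :
    MonotoneOn (lineN q c) (Icc (1 / 2) (2 / 3)) := by
  have hq0 : q ≠ 0 := by positivity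
  obtain ⟨M, hM, h, hconv, -, hall⟩ := hs
  set g : ℝ → ℝ := fun u => h (lineTens u) with hg
  have hg0 : ∀ u, 0 ≤ g u := fun u => (hall _ (lineTens_symm u) (lineTens_trace u)).1
  have hid : ∀ u : ℝ, 1 / 3 ≤ u → u ≤ 2 / 3 → M * g u ^ q = lineN q c u := by
    intro u hu1 hu2
    have h2 := (hall _ (lineTens_symm u) (lineTens_trace u)).2
    have hn : ‖lineTens u‖ ^ q = (‖lineTens u‖ ^ 2) ^ (q / 2) := by
      rw [← Real.rpow_natCast_mul (norm_nonneg _) 2 (q / 2)]; congr 1; push_cast; ring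
    rw [lam_lineTens hu1, lam_neg_lineTens hu2, hn, norm_sq_lineTens] at h2
    simp only [hg, lineN, lineNsq]
    linarith
  intro x hx y hy hxy
  rcases hM.eq_or_lt with hM0 | hMpos
  · -- `M = 0`: `N ≡ 0` on `[1/3, 2/3]`
    have hx0 := hid x (by linarith [hx.1]) hx.2
    have hy0 := hid y (by linarith [hy.1]) hy.2
    rw [← hM0, zero_mul] at hx0 hy0
    rw [← hx0, ← hy0]
  · -- `M > 0`: symmetry of `g` on `[1/3, 2/3]`, then convexity
    have hgs : g (1 - y) = g y := by
      have h1 := hid (1 - y) (by linarith [hy.2]) (by linarith [hy.1])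
      have h2 := hid y (by linarith [hy.1]) hy.2
      -- `N(1 − y) = N(y)` (the reflection `A ↦ −PAP` of the line; K24 `lineN_symm`, inlined here)
      have hNs : lineN q c (1 - y) = lineN q c y := by
        have h : lineNsq (1 - y) = lineNsq y := by unfold lineNsq; ring
        simp only [lineN, h, sub_sub_cancel]; ring
      rw [hNs] at h1
      have h3 : g (1 - y) ^ q = g y ^ q := mul_left_cancel₀ hMpos.ne' (h1.trans h2.symm)
      calc g (1 - y) = (g (1 - y) ^ q) ^ q⁻¹ := (Real.rpow_rpow_inv (hg0 _) hq0).symm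
        _ = (g y ^ q) ^ q⁻¹ := by rw [h3]
        _ = g y := Real.rpow_rpow_inv (hg0 _) hq0
    have hgxy : g x ≤ g y := by
      rcases eq_or_lt_of_le hy.1 with hy12 | hy12
      · have hxy' : x = y := le_antisymm hxy (by linarith [hx.1])
        rw [hxy']
      · have h2y : 0 < 2 * y - 1 := by linarith
        set t : ℝ := (y - x) / (2 * y - 1) with ht
        have ht0 : 0 ≤ t := div_nonneg (by linarith) h2y.le
        have ht1 : t ≤ 1 := by rw [ht, div_le_one h2y]; linarith [hx.1]
        have htm : t * (2 * y - 1) = y - x := by rw [ht, div_mul_cancel₀ _ h2y.ne']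
        have hcomb : t * (1 - y) + (1 - t) * y = x := by linear_combination (-1 : ℝ) * htm
        have hcv := hconv.2 (mem_univ (lineTens (1 - y))) (mem_univ (lineTens y)) ht0
          (by linarith : (0 : ℝ) ≤ 1 - t) (by ring : t + (1 - t) = 1)
        rw [← lineTens_affine (by ring : t + (1 - t) = 1), hcomb] at hcv
        simp only [smul_eq_mul] at hcv
        have e1 : h (lineTens x) = g x := rfl
        have e2 : h (lineTens (1 - y)) = g (1 - y) := rfl
        have e3 : h (lineTens y) = g y := rfl
        rw [e1, e2, e3, hgs] at hcv
        nlinarith [hcv]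
    rw [← hid x (by linarith [hx.1]) hx.2, ← hid y (by linarith [hy.1]) hy.2]
    exact mul_le_mul_of_nonneg_left (Real.rpow_le_rpow (hg0 x) hgxy (by linarith)) hM

/-- **From a splitting, `N′ ≥ 0` on `(1/2, 2/3)`.** [ours] -/
theorem lineN1_nonneg_of_splitting {q c : ℝ} (hq : 1 < q) (hs : TopBotEigSplitting q c) {u : ℝ}
    (hu1 : 1 / 2 < u) (hu2 : u < 2 / 3) : 0 ≤ lineN1 q c u := by
  have hmono := (lineN_monotoneOn_of_splitting hq hs).mono Ioo_subset_Icc_self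
  have h := hmono.derivWithin_nonneg (x := u)
  rwa [derivWithin_of_isOpen isOpen_Ioo ⟨hu1, hu2⟩,
    (hasDerivAt_lineN q c (by linarith) (by linarith)).deriv] at h

/-- **From a splitting, `N″(1/2) ≥ 0`** (the slopes of `N′ ≥ 0` from `N′(1/2) = 0` are non-negative on
`(1/2, 2/3)`; pass to the limit in the derivative of `N′` at `1/2`). [ours] -/
theorem lineN2_half_nonneg_of_splitting {q c : ℝ} (hq : 1 < q) (hs : TopBotEigSplitting q c) :
    0 ≤ lineN2 q c (1 / 2) := by
  have hder : HasDerivWithinAt (lineN1 q c) (lineN2 q c (1 / 2)) (Ioo (1 / 2) (2 / 3)) (1 / 2) :=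
    (hasDerivAt_lineN1 q c (by norm_num) (by norm_num)).hasDerivWithinAt
  have hnot : (1 / 2 : ℝ) ∉ Ioo (1 / 2 : ℝ) (2 / 3) := fun h => lt_irrefl _ h.1
  rw [hasDerivWithinAt_iff_tendsto_slope' hnot] at hder
  haveI : (𝓝[Ioo (1 / 2 : ℝ) (2 / 3)] (1 / 2)).NeBot := left_nhdsWithin_Ioo_neBot (by norm_num)
  refine ge_of_tendsto hder (eventually_nhdsWithin_of_forall fun u hu => ?_)
  rw [slope_def_field, lineN1_half, sub_zero]
  exact div_nonneg (lineN1_nonneg_of_splitting hq hs hu.1 hu.2) (by linarith [hu.1])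

/-- **Planar-share necessity, every real `q > 1`.** Every convex `1`-Lipschitz non-negative splitting
`λ(A)^q + λ(−A)^q = M·h(A)^q + c‖A‖^q` of the symmetrised top–bottom density on symmetric trace-free `3 × 3`
tensors has share `c ≤ c_pl(q) = ((q − 1)/3)·2^{1 − q/2}`. For `1 < q < 2` this is STRICTLY below K16's
axisymmetric ceiling `c_axi(q)` (by value: `c_pl(3/2) = 2^{1/4}/6 ≈ 0.1982 < c_axi(3/2) ≈ 0.2542`); at `q = 2`
both equal `1/3`; for `q > 2` it is above `c_axi(q)` (`c_pl(4) = 1/2 > 2/9`) and K16 is the binding ceiling.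
Search for candidate a priori estimates; no regularity claim. [ours; the planar necessity half of the share window] -/
theorem topBotEigSplitting_share_le_cPlanar {q c : ℝ} (hq : 1 < q) (hs : TopBotEigSplitting q c) :
    c ≤ cPlanar q := by
  have h := lineN2_half_nonneg_of_splitting hq hs
  rw [lineN2_half_eq_cPlanar] at h
  have hq0 : 0 < q := by linarith
  have h2 : 0 < 6 * q * (2 : ℝ) ^ (1 - q / 2) := by positivity
  nlinarith [h, h2]

/-- The same statement with the obligation written out (no tree constant but `TopEig.lam`). [ours; bookkeeping] -/
theorem share_le_cPlanar_of_convex_splitting {q c M : ℝ} (hq : 1 < q) (hM : 0 ≤ M)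
    {h : EuclideanSpace ℝ (Fin 3 × Fin 3) → ℝ} (hconv : ConvexOn ℝ univ h) (hlip : LipschitzWith 1 h)
    (hall : ∀ A : EuclideanSpace ℝ (Fin 3 × Fin 3), (∀ i j, A (i, j) = A (j, i)) →
      ∑ i, A (i, i) = 0 → 0 ≤ h A ∧ lam A ^ q + lam (-A) ^ q = M * h A ^ q + c * ‖A‖ ^ q) :
    c ≤ cPlanar q :=
  topBotEigSplitting_share_le_cPlanar hq ⟨M, hM, h, hconv, hlip, hall⟩

/-- **No splitting with a share above `c_pl(q)`**, every real `q > 1`. [ours] -/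
theorem not_topBotEigSplitting_of_cPlanar_lt {q c : ℝ} (hq : 1 < q) (hc : cPlanar q < c) :
    ¬ TopBotEigSplitting q c :=
  fun hs => absurd (topBotEigSplitting_share_le_cPlanar hq hs) (not_le.mpr hc)

/-- By value at `q = 3/2`: every splitting share is `< 1/5` (K16 alone gives `≤ c_axi(3/2) ≈ 0.254`). [ours] -/
theorem topBotEigSplitting_three_halves_share_lt {c : ℝ} (hs : TopBotEigSplitting (3 / 2) c) : c < 1 / 5 :=
  (topBotEigSplitting_share_le_cPlanar (by norm_num) hs).trans_lt cPlanar_three_halves_lt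

/-! ## P3. Below `q = 2` the planar share passes (N⁺) and (D) of the one-dimensional criterion -/

/-- **(N⁺) at the planar share, `1 < q ≤ 2`:** `0 < N(u)` on `[1/3, 2/3]` for `c = c_pl(q)`
(`u^q + (1 − u)^q ≥ 2·(1/2)^q ≥ (3/2)·(1/3)^{q/2}` by convexity of `t^q` and `(3/4)^{q/2} ≥ 3/4`, against
`c_pl(q)·(6u² − 6u + 2)^{q/2} ≤ (2(q − 1)/3)·(1/3)^{q/2}`). [ours] -/
theorem lineN_cPlanar_pos {q : ℝ} (hq : 1 < q) (hq2 : q ≤ 2) {u : ℝ} (hu1 : 1 / 3 ≤ u) (hu2 : u ≤ 2 / 3) :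
    0 < lineN q (cPlanar q) u := by
  have hq0 : 0 < q := by linarith
  set X : ℝ := (1 / 3 : ℝ) ^ (q / 2) with hX
  set Y : ℝ := (3 / 4 : ℝ) ^ (q / 2) with hY
  set P : ℝ := (2 : ℝ) ^ (q / 2) with hP
  have hX0 : 0 < X := Real.rpow_pos_of_pos (by norm_num) _
  have hP0 : 0 < P := Real.rpow_pos_of_pos (by norm_num) _
  have hY1 : 3 / 4 ≤ Y := by
    have h := Real.rpow_le_rpow_of_exponent_ge (by norm_num : (0 : ℝ) < 3 / 4) (by norm_num : (3 / 4 : ℝ) ≤ 1)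
      (by linarith : q / 2 ≤ 1)
    rwa [Real.rpow_one] at h
  -- `(1/2)^q = X·Y`
  have hhalf : (1 / 2 : ℝ) ^ q = X * Y := by
    rw [hX, hY, ← Real.mul_rpow (by norm_num) (by norm_num), show (1 / 3 : ℝ) * (3 / 4) = (1 / 2) ^ 2 by norm_num,
      ← Real.rpow_natCast_mul (by norm_num : (0 : ℝ) ≤ 1 / 2)]
    congr 1; push_cast; ring
  -- convexity of `t ↦ t^q`: `u^q + (1-u)^q ≥ 2 (1/2)^q`
  have hconv := (convexOn_rpow hq.le).2 (mem_Ici.mpr (by linarith : (0 : ℝ) ≤ u))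
    (mem_Ici.mpr (by linarith : (0 : ℝ) ≤ 1 - u)) (by norm_num : (0 : ℝ) ≤ 1 / 2) (by norm_num : (0 : ℝ) ≤ 1 / 2)
    (by norm_num)
  simp only [smul_eq_mul] at hconv
  rw [show (1 : ℝ) / 2 * u + 1 / 2 * (1 - u) = 1 / 2 by ring, hhalf] at hconv
  -- the share term: `s^(q/2) ≤ (2/3)^(q/2) = P·X`
  have hs : lineNsq u ≤ 2 / 3 := by unfold lineNsq; nlinarith
  have h1 : lineNsq u ^ (q / 2) ≤ P * X := by
    have h := Real.rpow_le_rpow (lineNsq_pos u).le hs (by linarith : 0 ≤ q / 2)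
    rwa [show (2 / 3 : ℝ) = 2 * (1 / 3) by norm_num, Real.mul_rpow (by norm_num) (by norm_num)] at h
  -- `c_pl(q) = ((q-1)/3)·2/P`
  have hc : cPlanar q = (q - 1) / 3 * (2 / P) := by
    rw [cPlanar, hP, Real.rpow_sub two_pos, Real.rpow_one]
  have hcs : cPlanar q * lineNsq u ^ (q / 2) ≤ 2 * (q - 1) / 3 * X := by
    calc cPlanar q * lineNsq u ^ (q / 2) ≤ cPlanar q * (P * X) :=
          mul_le_mul_of_nonneg_left h1 (cPlanar_pos hq).le
      _ = 2 * (q - 1) / 3 * X := by rw [hc]; field_simp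
  unfold lineN
  nlinarith [hconv, hcs, hX0, hY1, mul_le_mul_of_nonneg_left hY1 hX0.le]

/-- **(D) at the planar share, `1 < q ≤ 2`:** `c_pl(q)·(3u − 1)·(6u² − 6u + 2)^{q/2 − 1} ≤ u^{q − 1}` on
`[1/3, 2/3]` (`s^{q/2−1} ≤ (1/2)^{q/2−1} = 2^{1−q/2}` since `s ≥ 1/2` and the exponent is `≤ 0`; `2^{2−q} ≤ 2`;
`u^{q−1} ≥ u`). [ours] -/
theorem lineD_cPlanar {q : ℝ} (hq : 1 < q) (hq2 : q ≤ 2) {u : ℝ} (hu1 : 1 / 3 ≤ u) (hu2 : u ≤ 2 / 3) :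
    cPlanar q * (3 * u - 1) * lineNsq u ^ (q / 2 - 1) ≤ u ^ (q - 1) := by
  set A : ℝ := (2 : ℝ) ^ (1 - q / 2) with hA
  have hA0 : 0 < A := Real.rpow_pos_of_pos two_pos _
  -- `s^{q/2-1} ≤ A`
  have hs : 1 / 2 ≤ lineNsq u := by unfold lineNsq; nlinarith [sq_nonneg (u - 1 / 2)]
  have h1 : lineNsq u ^ (q / 2 - 1) ≤ A := by
    have h := Real.rpow_le_rpow_of_nonpos (by norm_num : (0 : ℝ) < 1 / 2) hs (by linarith : q / 2 - 1 ≤ 0)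
    rwa [half_rpow_half_sub_one] at h
  -- `A² = 2^{2-q} ≤ 2`
  have hA2 : A ^ 2 ≤ 2 := by
    rw [hA, ← Real.rpow_mul_natCast (by norm_num : (0 : ℝ) ≤ 2)]
    have h := Real.rpow_le_rpow_of_exponent_le (by norm_num : (1 : ℝ) ≤ 2)
      (by push_cast; linarith : (1 - q / 2) * ((2 : ℕ) : ℝ) ≤ 1)
    rwa [Real.rpow_one] at h
  -- `u ≤ u^{q-1}`
  have hu : u ≤ u ^ (q - 1) := by
    have h := Real.rpow_le_rpow_of_exponent_ge (by linarith : (0 : ℝ) < u) (by linarith : u ≤ 1)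
      (by linarith : q - 1 ≤ 1)
    rwa [Real.rpow_one] at h
  have h3u : 0 ≤ 3 * u - 1 := by linarith
  calc cPlanar q * (3 * u - 1) * lineNsq u ^ (q / 2 - 1)
      ≤ cPlanar q * (3 * u - 1) * A :=
        mul_le_mul_of_nonneg_left h1 (mul_nonneg (cPlanar_pos hq).le h3u)
    _ = (q - 1) / 3 * (3 * u - 1) * A ^ 2 := by rw [cPlanar, ← hA]; ring
    _ ≤ 1 / 3 * (3 * u - 1) * 2 := by
        have hq1 : (q - 1) / 3 ≤ 1 / 3 := by linarith
        have := mul_le_mul (mul_le_mul_of_nonneg_right hq1 h3u) hA2 (sq_nonneg A)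
          (mul_nonneg (by norm_num) h3u)
        linarith [this]
    _ ≤ u := by linarith
    _ ≤ u ^ (q - 1) := hu

end TopEig

end Summit.NavierStokesRegularity.FunctionalMining

end
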